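import Summits.BirchSwinnertonDyer.Rank1Residual.Supersingular.RankOneKimLevelKRecordShapeX7
import Summits.BirchSwinnertonDyer.Rank1Residual.Supersingular.IntModelMinimalityKrausTwoMore
import Summits.BirchSwinnertonDyer.Rank1Residual.Supersingular.RankOneSurjThreeCertificates_11
import HarnessLib

/-!
# Rank ONE at `p = 3`, `#Ш_an = 9`, `3 ∤ ∏c_ℓ`: per-pair RECORDS in the Kim-PRE level-27 currency — `BSD(E,3)` from ONE
# PRIME-level Kurihara number `δ̃_ℓ ≢ 0 (mod 27)` at a cyclic `ℓ ∈ 𝒫_3` (iw-2 ENGINE K v1.3 depth-3, population R1k3) and the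
# two-engine descent count `9 ∣ #Sel^(3)(E/ℚ)`, every side condition DECIDED in the kernel (cell `b2b-bsdres`, supersingular family
# prover B = unit `b2b-bsdres-additive-p3`, gen 23; class lead N6·O3, X7 joint B side; part X7A: 7 of 33 rows)

HONEST FRAMING (cell `b2b-bsdres-*`, verbatim): prove what is provable now; shrink each hard class to its core with data;
no claim beyond stated classes; COMBINATION classes deleted from PUBLISHED theorems only, CONSTRUCTION-shaped remainder
typed; this is not "finishing BSD". X7 / X8 stay CONSTRUCTION-SHAPED; NOT class theorems; nothing is booked; O3's / O4's marks
do not move. EVERY theorem below is CONDITIONAL on the ANNOUNCED preprint C.-H. Kim (app. R. Pollack), arXiv:2505.09121 Thm. 1.1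
(`hK25s`, OPEN binder) and takes AS BINDERS (i) the non-vanishing `kuriharaNumber D.f 27 ℓ ψ ≠ 0` of ONE level-27 Kurihara number
for a surjective `ψ_ℓ : (ℤ/ℓ)ˣ → ℤ/27` — the kernel does NOT compute that number; iw-2's ENGINE K v1.3 did (EVIDENCE:
`HOME/b2b-bsdres-iw-2/ENGINE-K-P9.md` §4 GEN 12 (D), `tables/engKp9_{pairs,levels}.tsv`; twisted `L`-values by the approximate functional
equation, certificates feq / round_resid / dft per level; ONE engine at depth 3 on these rows) — and (ii) the descent count
`9 ∣ #Sel^(3)(E/ℚ)` = gen 19's TWO-ENGINE exact 3-descent (`dim Sel₃ = 3` on both engines; x11b engine 1 / x10b engine 2, kit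
j132399+j136163+j136262 / j132400+j136164+j136263; `HOME/b2b-bsdres-additive-p3/g19/sha9core/R1SHA2-TABLE.md`). Population R1k3 =
r_an 1, X7/X8, surj(3), `v₃(∏c) + v₃(#Ш_an) = 2`, `q = 27`, `ν = 1`: 1 791 rows, 1 666 decided with `min ord₃ δ̃^{(3)} = 2` = Kim's
expected depth; the 33 rows here are the `#Ш_an = 9`, `3 ∤ ∏c` cells OPEN at engine-A ROUND 203 (gen-20 census) without a
level-27 record yet: O4@3 32, O3 1 (gen 21's `RankOneKimLevel27RecordsX8A/B` hold the other 19 O3 rows).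

WHAT THE KERNEL DECIDES PER ROW (shapes `X7RankOne/X8RankOne.bsdp_three_of_kim2025_OPEN_of_ainvs_of_kuriharaNumber_ne_zero_of_card_selmerGroup_of_countPointsFast`,
`RankOneKimLevelKRecordShapeX7.lean`, into gen 18's `RankOne.bsdp_of_kim2025_OPEN_of_casselsTate_of_kuriharaNumber_ne_zero_of_pow_dvd`,
`k = 3 ≤ 4`, `j = 1`): global minimality of the Cremona model (x11c bounded Kraus / gen-20 criterion₃), `3 ∤ Δ` and `#Ẽ(𝔽₃)` (class
X8: `∈ {1,7}`; class X7: `3 ∣ 4 − #Ẽ(𝔽₃)` plus an additive prime `q ∣ Δ, q ∣ c₄`), `ℓ ≥ 5` prime, `ℓ ∤ Δ`, `ℓ ≡ 1 (mod 27)`, the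
point count `#Ẽ(𝔽_ℓ) = n_ℓ` by prover A's `countPointsFast` (binary modular exponentiation, `decide +kernel`) with `27 ∣ n_ℓ` (so
`ℓ ∈ 𝒫_3`), CYCLICITY `#Ẽ(𝔽_ℓ)[3] ≤ 3` by the cube test `Δ^{(ℓ−1)/3} ≢ 1 (mod ℓ)` (n1011-p15); surj(3) is gen 21's kernel
certificate `surj_x7r1_/surj_x8r1_<label>_3`; the 3-adic tower needs no witness. OTHER BINDERS: `hCT`, `hGZK`, `hmod` PUBLISHED;
`D`; `r_an = 1` and `#Ш_an = q` with `ord₃ q = 2` (Cremona allbsd). READING (class lead / X7 joint B): on these rows BSD₃ holds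
modulo (Kim 2025 refereed) + (the engine's δ̃_ℓ mod 27) + (the two-engine descent count) + published facts — a SECOND conditional
route beside the gen-19/20 rem13 + descent records (tier-D composed citation `hK`). By Cassels–Tate squareness the level-27
number pins `ord₃ #Ш = 2` exactly (`≤ 2` from Kim's clause at `k = 3`, `≥ 1` from the descent bit).

References: [Kim2025RefinedTNC] Thm. 1.1 (ANNOUNCED, OPEN binder); [Kim2022StructureSelmer] §1.2.2, Thm. 1.9 (6), Conj. 1.10;
[SilvermanAEC2009] III.1, VII.1, VII.5, X.4.2, X.4.14; [IrelandRosen1990] Prop. 5.1.2; [Kraus1989]; [Cremona1997] §3.6;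
[Cremona2006] Table 1; [Miller2011LMS] Def. 1.1.
-/

set_option autoImplicit false

noncomputable section

open scoped Classical MatrixGroups ModularForm

open CongruenceSubgroup WeierstrassCurve Literature.NumberTheory.EllipticCurves
  Literature.NumberTheory.EllipticCurves.ModularForms
  Literature.NumberTheory.EllipticCurves.Rank1Residual
  Literature.NumberTheory.EllipticCurves.Rank1Residual.Typed
  Literature.NumberTheory.EllipticCurves.Rank1Residual.X11RankOneCertificates
  Summit.BirchSwinnertonDyer.BirchSwinnertonDyer.Rank1Residual.X11RankOne

namespace Summit.BirchSwinnertonDyer.Rank1Residual.Supersingular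

/-- **`61504bq1`** (O4@3 = X7@3 ∧ `r_an = 1`; Cremona model `[0, 0, 0, 3844, -238328]`, `N = 61504` = 2^6·31^2, `#Ш_an = 9`, `∏c_ℓ = 4` (`3`-unit: the expected depth is `k = ord₃ #Ш + 1 = 3`), `#E(ℚ)_tors = 1`): `BSD(E,3)` from the level-27 Kurihara number at the prime `ℓ = 271 ∈ 𝒫_3` — KERNEL: `ℓ ≡ 1 (mod 27)`, `#Ẽ(𝔽_{271}) = 270` (`countPointsFast`; `a_ℓ = 2 ≡ ℓ + 1 (mod 27)`), cube test `Δ^{(ℓ−1)/3} ≡ 242 ≢ 1 (mod 271)` (cyclic `3`-part; engine K: `Ẽ(𝔽_ℓ) ≅ ℤ/270`, `#Ẽ[3] = 3`), class X7 (`#Ẽ(𝔽₃) = 4`, additive at `2`), minimality, surj(3) (`surj_x7r1_61504bq1_3`); BINDER `hδ`: iw-2 ENGINE K v1.3 depth-3 (population R1k3, `tables/engKp9_levels.tsv`, kit j136997; ONE engine at this level; certificates feq ≤ 2.7e-15, round_resid ≤ 1.5e-14, dft ≤ 2.5e-13, D = 1): `δ̃_ℓ ≡ 9 (mod 27)` (tower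 [0, 0, 9], `ord₃ = 2 < 3`); other non-zero levels ℓ = 433: δ̃ ≡ 9 (mod 27); all levels run (ℓ:δ̃ mod 27) 271:9, 433:9. Non-vanishing mod 27 does not depend on the surjective `ψ_ℓ` (ν = 1: a change of `ψ_ℓ` multiplies `δ̃_ℓ` by a unit), so `hδ` is stated for an arbitrary surjective `ψ`. BINDER `hcard` = gen-19 TWO-ENGINE exact 3-descent `dim Sel₃ = 3` (engine 1 EXACT(bnfcertify1+3sat) j132399 / engine 2 EXACT(bnfcertify1+3sat) j132400, dimSha[3]=2; verdict TWO-ENGINE-EXACT-LOWER; `HOME/b2b-bsdres-additive-p3/g19/sha9core/R1SHA2-TABLE.md`). CONDITIONAL on `hK25s` (OPEN); `hCT`/`hGZK`/`hmod` PUBLISHED; `r_an = 1`, `#Ш_an` Cremona. A SECOND conditional route on this cell beside the gen-19/20 rem13 + descent record (tier-D `hK`). Per pair; nothing booked. [claim: Kim2025RefinedTNC, status: under-review] [cite: Kim2025RefinedTNC, Thm. 1.1 (ANNOUNCED, OPEN binder)] [cite: Kim2022StructureSelmer, §1.2.2] [cite: SilvermanAEC2009, Thm. X.4.2(a) and Thm.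 X.4.14] [cite: Cremona2006, Table 1 (Cremona label 61504bq1)] -/
theorem bsdp_x7r1kim27_61504bq1
    (hK25s : Kim2025.thm11_kimShaLength_of_integralPeriod_OPEN)
    (hCT : exists_casselsTate_pairing (K := ℚ))
    (hGZK : rank_eq_analyticRank_of_analyticRank_le_one) (hmod : hasEntireLFunction_rat)
    (W : WeierstrassCurve ℚ) (hW : W = ⟨0, 0, 0, 3844, -238328⟩) (hr : W.analyticRank = 1)
    {N : ℕ} [NeZero N] (D : ModularParametrizationData W N)
    (ψ : (ℓ'' : ℕ) → (ZMod ℓ'')ˣ →* Multiplicative (ZMod (3 ^ 3))) (hψ : Function.Surjective (ψ 271))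
    (hδ : kuriharaNumber D.f (3 ^ 3) 271 ψ ≠ 0)
    (hcard : 3 ^ 2 ∣ Nat.card (W.selmerGroup ((3 : ℕ) : ℤ)))
    {q : ℚ} (hq : shaAn W = (q : ℂ)) (hv : padicValRat 3 q = 2) : BSDp W 3 := by
  subst hW
  exact X7RankOne.bsdp_three_of_kim2025_OPEN_of_ainvs_of_kuriharaNumber_ne_zero_of_card_selmerGroup_of_countPointsFast
    hK25s hCT hGZK hmod 0 0 0 3844 (-238328)
    (isGloballyMinimal_of_krausCriterion_bounded 0 0 0 3844 (-238328)
      (by decide +kernel) (by decide +kernel) (by decide +kernel))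
    (by decide) (n₃ := 4) (by decide +kernel) (by decide) 2 (by norm_num) (by decide) (by decide)
    surj_x7r1_61504bq1_3 hr D (k := 3) (by norm_num) (by norm_num)
    271 (hℓ := ⟨by norm_num⟩) (by norm_num) (by decide) (by decide) (nℓ := 270)
    (by decide +kernel)
    (by decide) (by decide +kernel) (by decide +kernel) ψ hψ hδ hcard hq hv

/-- **`63002a1`** (O4@3 = X7@3 ∧ `r_an = 1`; Cremona model `[1, -1, 0, -1229171, -524019275]`, `N = 63002` = 2·17^2·109, `#Ш_an = 9`, `∏c_ℓ = 8` (`3`-unit: the expected depth is `k = ord₃ #Ш + 1 = 3`), `#E(ℚ)_tors = 2`): `BSD(E,3)` from the level-27 Kurihara number at the prime `ℓ = 2593 ∈ 𝒫_3` — KERNEL: `ℓ ≡ 1 (mod 27)`, `#Ẽ(𝔽_{2593}) = 2592` (`countPointsFast`; `a_ℓ = 2 ≡ ℓ + 1 (mod 27)`), cube test `Δ^{(ℓ−1)/3} ≡ 1137 ≢ 1 (mod 2593)` (cyclic `3`-part; engine K: `Ẽ(𝔽_ℓ) ≅ ℤ/1296x2`, `#Ẽ[3] = 3`), class X7 (`#Ẽ(𝔽₃)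 = 4`, additive at `17`), minimality, surj(3) (`surj_x7r1_63002a1_3`); BINDER `hδ`: iw-2 ENGINE K v1.3 depth-3 (population R1k3, `tables/engKp9_levels.tsv`, kit j137000; ONE engine at this level; certificates feq ≤ 3.5e-15, round_resid ≤ 4.5e-13, dft ≤ 2.3e-12, D = 1): `δ̃_ℓ ≡ 18 (mod 27)` (tower [0, 0, 18], `ord₃ = 2 < 3`); other non-zero levels ℓ = 7507: δ̃ ≡ 18 (mod 27); all levels run (ℓ:δ̃ mod 27) 2593:18, 7507:18. Non-vanishing mod 27 does not depend on the surjective `ψ_ℓ` (ν = 1: a change of `ψ_ℓ` multiplies `δ̃_ℓ` by a unit), so `hδ` is stated for an arbitrary surjective `ψ`. BINDER `hcard` = gen-19 TWO-ENGINE exact 3-descent `dim Sel₃ = 3` (engine 1 EXACT(bnfcertify1+3sat) j132399 / engine 2 EXACT(bnfcertify1+3sat) j132400, dimSha[3]=2; verdict TWO-ENGINE-EXACT-LOWER; `HOME/b2b-bsdres-additive-p3/g19/sha9core/R1SHA2-TABLE.md`). CONDITIONAL on `hK25s` (OPEN); `hCT`/`hGZK`/`hmod` PUBLISHED; `r_an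 = 1`, `#Ш_an` Cremona. A SECOND conditional route on this cell beside the gen-19/20 rem13 + descent record (tier-D `hK`). Per pair; nothing booked. [claim: Kim2025RefinedTNC, status: under-review] [cite: Kim2025RefinedTNC, Thm. 1.1 (ANNOUNCED, OPEN binder)] [cite: Kim2022StructureSelmer, §1.2.2] [cite: SilvermanAEC2009, Thm. X.4.2(a) and Thm. X.4.14] [cite: Cremona2006, Table 1 (Cremona label 63002a1)] -/
theorem bsdp_x7r1kim27_63002a1
    (hK25s : Kim2025.thm11_kimShaLength_of_integralPeriod_OPEN)
    (hCT : exists_casselsTate_pairing (K := ℚ))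
    (hGZK : rank_eq_analyticRank_of_analyticRank_le_one) (hmod : hasEntireLFunction_rat)
    (W : WeierstrassCurve ℚ) (hW : W = ⟨1, -1, 0, -1229171, -524019275⟩) (hr : W.analyticRank = 1)
    {N : ℕ} [NeZero N] (D : ModularParametrizationData W N)
    (ψ : (ℓ'' : ℕ) → (ZMod ℓ'')ˣ →* Multiplicative (ZMod (3 ^ 3))) (hψ : Function.Surjective (ψ 2593))
    (hδ : kuriharaNumber D.f (3 ^ 3) 2593 ψ ≠ 0)
    (hcard : 3 ^ 2 ∣ Nat.card (W.selmerGroup ((3 : ℕ) : ℤ)))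
    {q : ℚ} (hq : shaAn W = (q : ℂ)) (hv : padicValRat 3 q = 2) : BSDp W 3 := by
  subst hW
  exact X7RankOne.bsdp_three_of_kim2025_OPEN_of_ainvs_of_kuriharaNumber_ne_zero_of_card_selmerGroup_of_countPointsFast
    hK25s hCT hGZK hmod 1 (-1) 0 (-1229171) (-524019275)
    (isGloballyMinimal_of_krausCriterion_bounded 1 (-1) 0 (-1229171) (-524019275)
      (by decide +kernel) (by decide +kernel) (by decide +kernel))
    (by decide) (n₃ := 4) (by decide +kernel) (by decide) 17 (by norm_num) (by decide) (by decide)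
    surj_x7r1_63002a1_3 hr D (k := 3) (by norm_num) (by norm_num)
    2593 (hℓ := ⟨by norm_num⟩) (by norm_num) (by decide) (by decide) (nℓ := 2592)
    (by decide +kernel)
    (by decide) (by decide +kernel) (by decide +kernel) ψ hψ hδ hcard hq hv

/-- **`82288o1`** (O4@3 = X7@3 ∧ `r_an = 1`; Cremona model `[0, 0, 0, -82136, -10008697]`, `N = 82288` = 2^4·37·139, `#Ш_an = 9`, `∏c_ℓ = 2` (`3`-unit: the expected depth is `k = ord₃ #Ш + 1 = 3`), `#E(ℚ)_tors = 1`): `BSD(E,3)` from the level-27 Kurihara number at the prime `ℓ = 6211 ∈ 𝒫_3` — KERNEL: `ℓ ≡ 1 (mod 27)`, `#Ẽ(𝔽_{6211}) = 6210` (`countPointsFast`; `a_ℓ = 2 ≡ ℓ + 1 (mod 27)`), cube test `Δ^{(ℓ−1)/3} ≡ 136 ≢ 1 (mod 6211)` (cyclic `3`-part; engine K: `Ẽ(𝔽_ℓ) ≅ ℤ/6210`, `#Ẽ[3] = 3`), class X7 (`#Ẽ(𝔽₃) = 4`, additive at `2`), minimality, surj(3) (`surj_x7r1_82288o1_3`);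 BINDER `hδ`: iw-2 ENGINE K v1.3 depth-3 (population R1k3, `tables/engKp9_levels.tsv`, kit j136996; ONE engine at this level; certificates feq ≤ 3.4e-15, round_resid ≤ 7.1e-14, dft ≤ 6.4e-13, D = 1): `δ̃_ℓ ≡ 9 (mod 27)` (tower [0, 0, 9], `ord₃ = 2 < 3`); all levels run (ℓ:δ̃ mod 27) 1999:0, 2377:0, 6211:9. Non-vanishing mod 27 does not depend on the surjective `ψ_ℓ` (ν = 1: a change of `ψ_ℓ` multiplies `δ̃_ℓ` by a unit), so `hδ` is stated for an arbitrary surjective `ψ`. BINDER `hcard` = gen-19 TWO-ENGINE exact 3-descent `dim Sel₃ = 3` (engine 1 EXACT(bnfcertify1+3sat) j132399 / engine 2 EXACT(bnfcertify1+3sat) j132400, dimSha[3]=2; verdict TWO-ENGINE-EXACT-LOWER; `HOME/b2b-bsdres-additive-p3/g19/sha9core/R1SHA2-TABLE.md`). CONDITIONAL on `hK25s` (OPEN); `hCT`/`hGZK`/`hmod` PUBLISHED; `r_an = 1`, `#Ш_an` Cremona. A SECOND conditional route on this cell beside the gen-19/20 rem13 + descent record (tier-D `hK`). Per pair; nothing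 booked. [claim: Kim2025RefinedTNC, status: under-review] [cite: Kim2025RefinedTNC, Thm. 1.1 (ANNOUNCED, OPEN binder)] [cite: Kim2022StructureSelmer, §1.2.2] [cite: SilvermanAEC2009, Thm. X.4.2(a) and Thm. X.4.14] [cite: Cremona2006, Table 1 (Cremona label 82288o1)] -/
theorem bsdp_x7r1kim27_82288o1
    (hK25s : Kim2025.thm11_kimShaLength_of_integralPeriod_OPEN)
    (hCT : exists_casselsTate_pairing (K := ℚ))
    (hGZK : rank_eq_analyticRank_of_analyticRank_le_one) (hmod : hasEntireLFunction_rat)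
    (W : WeierstrassCurve ℚ) (hW : W = ⟨0, 0, 0, -82136, -10008697⟩) (hr : W.analyticRank = 1)
    {N : ℕ} [NeZero N] (D : ModularParametrizationData W N)
    (ψ : (ℓ'' : ℕ) → (ZMod ℓ'')ˣ →* Multiplicative (ZMod (3 ^ 3))) (hψ : Function.Surjective (ψ 6211))
    (hδ : kuriharaNumber D.f (3 ^ 3) 6211 ψ ≠ 0)
    (hcard : 3 ^ 2 ∣ Nat.card (W.selmerGroup ((3 : ℕ) : ℤ)))
    {q : ℚ} (hq : shaAn W = (q : ℂ)) (hv : padicValRat 3 q = 2) : BSDp W 3 := by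
  subst hW
  exact X7RankOne.bsdp_three_of_kim2025_OPEN_of_ainvs_of_kuriharaNumber_ne_zero_of_card_selmerGroup_of_countPointsFast
    hK25s hCT hGZK hmod 0 0 0 (-82136) (-10008697)
    (isGloballyMinimal_of_krausCriterion_bounded 0 0 0 (-82136) (-10008697)
      (by decide +kernel) (by decide +kernel) (by decide +kernel))
    (by decide) (n₃ := 4) (by decide +kernel) (by decide) 2 (by norm_num) (by decide) (by decide)
    surj_x7r1_82288o1_3 hr D (k := 3) (by norm_num) (by norm_num)
    6211 (hℓ := ⟨by norm_num⟩) (by norm_num) (by decide) (by decide) (nℓ := 6210)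
    (by decide +kernel)
    (by decide) (by decide +kernel) (by decide +kernel) ψ hψ hδ hcard hq hv

/-- **`121958b1`** (O4@3 = X7@3 ∧ `r_an = 1`; Cremona model `[1, -1, 0, -407255, -110122723]`, `N = 121958` = 2·17^2·211, `#Ш_an = 9`, `∏c_ℓ = 4` (`3`-unit: the expected depth is `k = ord₃ #Ш + 1 = 3`), `#E(ℚ)_tors = 1`): `BSD(E,3)` from the level-27 Kurihara number at the prime `ℓ = 10531 ∈ 𝒫_3` — KERNEL: `ℓ ≡ 1 (mod 27)`, `#Ẽ(𝔽_{10531}) = 10584` (`countPointsFast`; `a_ℓ = -52 ≡ ℓ + 1 (mod 27)`), cube test `Δ^{(ℓ−1)/3} ≡ 5450 ≢ 1 (mod 10531)` (cyclic `3`-part; engine K: `Ẽ(𝔽_ℓ) ≅ ℤ/5292x2`, `#Ẽ[3] = 3`), class X7 (`#Ẽ(𝔽₃) = 4`, additive at `17`), minimality, surj(3) (`surj_x7r1_121958b1_3`); BINDER `hδ`: iw-2 ENGINE K v1.3 depth-3 (population R1k3, `tables/engKp9_levels.tsv`, kit j136990; ONE engine at this level; certificates feq ≤ 4.7e-15, round_resid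 ≤ 2.3e-13, dft ≤ 1.6e-12, D = 1): `δ̃_ℓ ≡ 9 (mod 27)` (tower [0, 0, 9], `ord₃ = 2 < 3`); other non-zero levels ℓ = 12637: δ̃ ≡ 9 (mod 27); all levels run (ℓ:δ̃ mod 27) 10531:9, 12637:9. Non-vanishing mod 27 does not depend on the surjective `ψ_ℓ` (ν = 1: a change of `ψ_ℓ` multiplies `δ̃_ℓ` by a unit), so `hδ` is stated for an arbitrary surjective `ψ`. BINDER `hcard` = gen-19 TWO-ENGINE exact 3-descent `dim Sel₃ = 3` (engine 1 EXACT(bnfcertify1+3sat) j132399 / engine 2 EXACT(bnfcertify1+3sat) j132400, dimSha[3]=2; verdict TWO-ENGINE-EXACT-LOWER; `HOME/b2b-bsdres-additive-p3/g19/sha9core/R1SHA2-TABLE.md`). CONDITIONAL on `hK25s` (OPEN); `hCT`/`hGZK`/`hmod` PUBLISHED; `r_an = 1`, `#Ш_an` Cremona. A SECOND conditional route on this cell beside the gen-19/20 rem13 + descent record (tier-D `hK`). Per pair; nothing booked. [claim: Kim2025RefinedTNC, status: under-review] [cite: Kim2025RefinedTNC, Thm. 1.1 (ANNOUNCED, OPEN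 binder)] [cite: Kim2022StructureSelmer, §1.2.2] [cite: SilvermanAEC2009, Thm. X.4.2(a) and Thm. X.4.14] [cite: Cremona2006, Table 1 (Cremona label 121958b1)] -/
theorem bsdp_x7r1kim27_121958b1
    (hK25s : Kim2025.thm11_kimShaLength_of_integralPeriod_OPEN)
    (hCT : exists_casselsTate_pairing (K := ℚ))
    (hGZK : rank_eq_analyticRank_of_analyticRank_le_one) (hmod : hasEntireLFunction_rat)
    (W : WeierstrassCurve ℚ) (hW : W = ⟨1, -1, 0, -407255, -110122723⟩) (hr : W.analyticRank = 1)
    {N : ℕ} [NeZero N] (D : ModularParametrizationData W N)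
    (ψ : (ℓ'' : ℕ) → (ZMod ℓ'')ˣ →* Multiplicative (ZMod (3 ^ 3))) (hψ : Function.Surjective (ψ 10531))
    (hδ : kuriharaNumber D.f (3 ^ 3) 10531 ψ ≠ 0)
    (hcard : 3 ^ 2 ∣ Nat.card (W.selmerGroup ((3 : ℕ) : ℤ)))
    {q : ℚ} (hq : shaAn W = (q : ℂ)) (hv : padicValRat 3 q = 2) : BSDp W 3 := by
  subst hW
  exact X7RankOne.bsdp_three_of_kim2025_OPEN_of_ainvs_of_kuriharaNumber_ne_zero_of_card_selmerGroup_of_countPointsFast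
    hK25s hCT hGZK hmod 1 (-1) 0 (-407255) (-110122723)
    (isGloballyMinimal_of_krausCriterion_bounded 1 (-1) 0 (-407255) (-110122723)
      (by decide +kernel) (by decide +kernel) (by decide +kernel))
    (by decide) (n₃ := 4) (by decide +kernel) (by decide) 17 (by norm_num) (by decide) (by decide)
    surj_x7r1_121958b1_3 hr D (k := 3) (by norm_num) (by norm_num)
    10531 (hℓ := ⟨by norm_num⟩) (by norm_num) (by decide) (by decide) (nℓ := 10584)
    (by decide +kernel)
    (by decide) (by decide +kernel) (by decide +kernel) ψ hψ hδ hcard hq hv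

/-- **`152912d1`** (O4@3 = X7@3 ∧ `r_an = 1`; Cremona model `[0, 0, 0, -31952, -2198352]`, `N = 152912` = 2^4·19·503, `#Ш_an = 9`, `∏c_ℓ = 2` (`3`-unit: the expected depth is `k = ord₃ #Ш + 1 = 3`), `#E(ℚ)_tors = 1`): `BSD(E,3)` from the level-27 Kurihara number at the prime `ℓ = 7237 ∈ 𝒫_3` — KERNEL: `ℓ ≡ 1 (mod 27)`, `#Ẽ(𝔽_{7237}) = 7155` (`countPointsFast`; `a_ℓ = 83 ≡ ℓ + 1 (mod 27)`), cube test `Δ^{(ℓ−1)/3} ≡ 5406 ≢ 1 (mod 7237)` (cyclic `3`-part; engine K: `Ẽ(𝔽_ℓ) ≅ ℤ/7155`, `#Ẽ[3] = 3`), class X7 (`#Ẽ(𝔽₃) = 4`, additive at `2`), minimality, surj(3) (`surj_x7r1_152912d1_3`); BINDER `hδ`: iw-2 ENGINE K v1.3 depth-3 (population R1k3, `tables/engKp9_levels.tsv`, kit j136989; ONE engine at this level; certificates feq ≤ 2.7e-15, round_resid ≤ 8.5e-14, dft ≤ 5.3e-13, D = 1): `δ̃_ℓ ≡ 9 (mod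 27)` (tower [0, 0, 9], `ord₃ = 2 < 3`); all levels run (ℓ:δ̃ mod 27) 7237:9, 9721:0. Non-vanishing mod 27 does not depend on the surjective `ψ_ℓ` (ν = 1: a change of `ψ_ℓ` multiplies `δ̃_ℓ` by a unit), so `hδ` is stated for an arbitrary surjective `ψ`. BINDER `hcard` = gen-19 TWO-ENGINE exact 3-descent `dim Sel₃ = 3` (engine 1 EXACT(bnfcertify1+3sat) j132399 / engine 2 EXACT(bnfcertify1+3sat) j132400, dimSha[3]=2; verdict TWO-ENGINE-EXACT-LOWER; `HOME/b2b-bsdres-additive-p3/g19/sha9core/R1SHA2-TABLE.md`). CONDITIONAL on `hK25s` (OPEN); `hCT`/`hGZK`/`hmod` PUBLISHED; `r_an = 1`, `#Ш_an` Cremona. A SECOND conditional route on this cell beside the gen-19/20 rem13 + descent record (tier-D `hK`). Per pair; nothing booked. [claim: Kim2025RefinedTNC, status: under-review] [cite: Kim2025RefinedTNC, Thm. 1.1 (ANNOUNCED, OPEN binder)] [cite: Kim2022StructureSelmer, §1.2.2] [cite: SilvermanAEC2009, Thm. X.4.2(a) and Thm. X.4.14] [cite: Cremona2006, Table 1 (Cremona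 label 152912d1)] -/
theorem bsdp_x7r1kim27_152912d1
    (hK25s : Kim2025.thm11_kimShaLength_of_integralPeriod_OPEN)
    (hCT : exists_casselsTate_pairing (K := ℚ))
    (hGZK : rank_eq_analyticRank_of_analyticRank_le_one) (hmod : hasEntireLFunction_rat)
    (W : WeierstrassCurve ℚ) (hW : W = ⟨0, 0, 0, -31952, -2198352⟩) (hr : W.analyticRank = 1)
    {N : ℕ} [NeZero N] (D : ModularParametrizationData W N)
    (ψ : (ℓ'' : ℕ) → (ZMod ℓ'')ˣ →* Multiplicative (ZMod (3 ^ 3))) (hψ : Function.Surjective (ψ 7237))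
    (hδ : kuriharaNumber D.f (3 ^ 3) 7237 ψ ≠ 0)
    (hcard : 3 ^ 2 ∣ Nat.card (W.selmerGroup ((3 : ℕ) : ℤ)))
    {q : ℚ} (hq : shaAn W = (q : ℂ)) (hv : padicValRat 3 q = 2) : BSDp W 3 := by
  subst hW
  exact X7RankOne.bsdp_three_of_kim2025_OPEN_of_ainvs_of_kuriharaNumber_ne_zero_of_card_selmerGroup_of_countPointsFast
    hK25s hCT hGZK hmod 0 0 0 (-31952) (-2198352)
    (isGloballyMinimal_of_krausCriterion_bounded 0 0 0 (-31952) (-2198352)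
      (by decide +kernel) (by decide +kernel) (by decide +kernel))
    (by decide) (n₃ := 4) (by decide +kernel) (by decide) 2 (by norm_num) (by decide) (by decide)
    surj_x7r1_152912d1_3 hr D (k := 3) (by norm_num) (by norm_num)
    7237 (hℓ := ⟨by norm_num⟩) (by norm_num) (by decide) (by decide) (nℓ := 7155)
    (by decide +kernel)
    (by decide) (by decide +kernel) (by decide +kernel) ψ hψ hδ hcard hq hv

/-- **`162712h1`** (O4@3 = X7@3 ∧ `r_an = 1`; Cremona model `[0, 0, 0, -286595, -58994194]`, `N = 162712` = 2^3·11·43^2, `#Ш_an = 9`, `∏c_ℓ = 8` (`3`-unit: the expected depth is `k = ord₃ #Ш + 1 = 3`), `#E(ℚ)_tors = 2`): `BSD(E,3)` from the level-27 Kurihara number at the prime `ℓ = 271 ∈ 𝒫_3` — KERNEL: `ℓ ≡ 1 (mod 27)`, `#Ẽ(𝔽_{271}) = 270` (`countPointsFast`; `a_ℓ = 2 ≡ ℓ + 1 (mod 27)`), cube test `Δ^{(ℓ−1)/3} ≡ 242 ≢ 1 (mod 271)` (cyclic `3`-part; engine K: `Ẽ(𝔽_ℓ) ≅ ℤ/270`,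 `#Ẽ[3] = 3`), class X7 (`#Ẽ(𝔽₃) = 4`, additive at `2`), minimality, surj(3) (`surj_x7r1_162712h1_3`); BINDER `hδ`: iw-2 ENGINE K v1.3 depth-3 (population R1k3, `tables/engKp9_levels.tsv`, kit j140813; ONE engine at this level; certificates feq ≤ 2.5e-15, round_resid ≤ 2.8e-14, dft ≤ 3.4e-13, D = 1): `δ̃_ℓ ≡ 18 (mod 27)` (tower [0, 0, 18], `ord₃ = 2 < 3`); other non-zero levels ℓ = 433: δ̃ ≡ 18 (mod 27); all levels run (ℓ:δ̃ mod 27) 271:18, 433:18. Non-vanishing mod 27 does not depend on the surjective `ψ_ℓ` (ν = 1: a change of `ψ_ℓ` multiplies `δ̃_ℓ` by a unit), so `hδ` is stated for an arbitrary surjective `ψ`. BINDER `hcard` = gen-19 TWO-ENGINE exact 3-descent `dim Sel₃ = 3` (engine 1 EXACT(bnfcertify1+3sat) j132399 / engine 2 EXACT(bnfcertify1+3sat) j132400, dimSha[3]=2; verdict TWO-ENGINE-EXACT-LOWER; `HOME/b2b-bsdres-additive-p3/g19/sha9core/R1SHA2-TABLE.md`). CONDITIONAL on `hK25s` (OPEN);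 `hCT`/`hGZK`/`hmod` PUBLISHED; `r_an = 1`, `#Ш_an` Cremona. A SECOND conditional route on this cell beside the gen-19/20 rem13 + descent record (tier-D `hK`). Per pair; nothing booked. [claim: Kim2025RefinedTNC, status: under-review] [cite: Kim2025RefinedTNC, Thm. 1.1 (ANNOUNCED, OPEN binder)] [cite: Kim2022StructureSelmer, §1.2.2] [cite: SilvermanAEC2009, Thm. X.4.2(a) and Thm. X.4.14] [cite: Cremona2006, Table 1 (Cremona label 162712h1)] -/
theorem bsdp_x7r1kim27_162712h1
    (hK25s : Kim2025.thm11_kimShaLength_of_integralPeriod_OPEN)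
    (hCT : exists_casselsTate_pairing (K := ℚ))
    (hGZK : rank_eq_analyticRank_of_analyticRank_le_one) (hmod : hasEntireLFunction_rat)
    (W : WeierstrassCurve ℚ) (hW : W = ⟨0, 0, 0, -286595, -58994194⟩) (hr : W.analyticRank = 1)
    {N : ℕ} [NeZero N] (D : ModularParametrizationData W N)
    (ψ : (ℓ'' : ℕ) → (ZMod ℓ'')ˣ →* Multiplicative (ZMod (3 ^ 3))) (hψ : Function.Surjective (ψ 271))
    (hδ : kuriharaNumber D.f (3 ^ 3) 271 ψ ≠ 0)
    (hcard : 3 ^ 2 ∣ Nat.card (W.selmerGroup ((3 : ℕ) : ℤ)))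
    {q : ℚ} (hq : shaAn W = (q : ℂ)) (hv : padicValRat 3 q = 2) : BSDp W 3 := by
  subst hW
  exact X7RankOne.bsdp_three_of_kim2025_OPEN_of_ainvs_of_kuriharaNumber_ne_zero_of_card_selmerGroup_of_countPointsFast
    hK25s hCT hGZK hmod 0 0 0 (-286595) (-58994194)
    (isGloballyMinimal_of_krausCriterion_bounded 0 0 0 (-286595) (-58994194)
      (by decide +kernel) (by decide +kernel) (by decide +kernel))
    (by decide) (n₃ := 4) (by decide +kernel) (by decide) 2 (by norm_num) (by decide) (by decide)
    surj_x7r1_162712h1_3 hr D (k := 3) (by norm_num) (by norm_num)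
    271 (hℓ := ⟨by norm_num⟩) (by norm_num) (by decide) (by decide) (nℓ := 270)
    (by decide +kernel)
    (by decide) (by decide +kernel) (by decide +kernel) ψ hψ hδ hcard hq hv

/-- **`175591d1`** (O4@3 = X7@3 ∧ `r_an = 1`; Cremona model `[1, -1, 0, -17713175, 28698543082]`, `N = 175591` = 13^2·1039, `#Ш_an = 9`, `∏c_ℓ = 2` (`3`-unit: the expected depth is `k = ord₃ #Ш + 1 = 3`), `#E(ℚ)_tors = 1`): `BSD(E,3)` from the level-27 Kurihara number at the prime `ℓ = 11719 ∈ 𝒫_3` — KERNEL: `ℓ ≡ 1 (mod 27)`, `#Ẽ(𝔽_{11719}) = 11772` (`countPointsFast`; `a_ℓ = -52 ≡ ℓ + 1 (mod 27)`), cube test `Δ^{(ℓ−1)/3} ≡ 187 ≢ 1 (mod 11719)` (cyclic `3`-part; engine K: `Ẽ(𝔽_ℓ) ≅ ℤ/11772`, `#Ẽ[3] = 3`), class X7 (`#Ẽ(𝔽₃) = 4`, additive at `13`), minimality, surj(3) (`surj_x7r1_175591d1_3`); BINDER `hδ`: iw-2 ENGINE K v1.3 depth-3 (population R1k3, `tables/engKp9_levels.tsv`,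 kit j136996; ONE engine at this level; certificates feq ≤ 3.1e-15, round_resid ≤ 1.1e-13, dft ≤ 6.0e-13, D = 1): `δ̃_ℓ ≡ 18 (mod 27)` (tower [0, 0, 18], `ord₃ = 2 < 3`); all levels run (ℓ:δ̃ mod 27) 7669:0, 8209:0, 11719:18. Non-vanishing mod 27 does not depend on the surjective `ψ_ℓ` (ν = 1: a change of `ψ_ℓ` multiplies `δ̃_ℓ` by a unit), so `hδ` is stated for an arbitrary surjective `ψ`. BINDER `hcard` = gen-19 TWO-ENGINE exact 3-descent `dim Sel₃ = 3` (engine 1 GRH(3sat) j136163 / engine 2 EXACT(bnfcertify1+3sat) j132400, dimSha[3]=2; verdict TWO-ENGINE-LOWERBOUND(dim>=3 both; GRH(3sat) / e2 EXACT); `HOME/b2b-bsdres-additive-p3/g19/sha9core/R1SHA2-TABLE.md`). CONDITIONAL on `hK25s` (OPEN); `hCT`/`hGZK`/`hmod` PUBLISHED; `r_an = 1`, `#Ш_an` Cremona. A SECOND conditional route on this cell beside the gen-19/20 rem13 + descent record (tier-D `hK`). Per pair; nothing booked. [claim: Kim2025RefinedTNC, status: under-review] [cite: Kim2025RefinedTNC,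 Thm. 1.1 (ANNOUNCED, OPEN binder)] [cite: Kim2022StructureSelmer, §1.2.2] [cite: SilvermanAEC2009, Thm. X.4.2(a) and Thm. X.4.14] [cite: Cremona2006, Table 1 (Cremona label 175591d1)] -/
theorem bsdp_x7r1kim27_175591d1
    (hK25s : Kim2025.thm11_kimShaLength_of_integralPeriod_OPEN)
    (hCT : exists_casselsTate_pairing (K := ℚ))
    (hGZK : rank_eq_analyticRank_of_analyticRank_le_one) (hmod : hasEntireLFunction_rat)
    (W : WeierstrassCurve ℚ) (hW : W = ⟨1, -1, 0, -17713175, 28698543082⟩) (hr : W.analyticRank = 1)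
    {N : ℕ} [NeZero N] (D : ModularParametrizationData W N)
    (ψ : (ℓ'' : ℕ) → (ZMod ℓ'')ˣ →* Multiplicative (ZMod (3 ^ 3))) (hψ : Function.Surjective (ψ 11719))
    (hδ : kuriharaNumber D.f (3 ^ 3) 11719 ψ ≠ 0)
    (hcard : 3 ^ 2 ∣ Nat.card (W.selmerGroup ((3 : ℕ) : ℤ)))
    {q : ℚ} (hq : shaAn W = (q : ℂ)) (hv : padicValRat 3 q = 2) : BSDp W 3 := by
  subst hW
  exact X7RankOne.bsdp_three_of_kim2025_OPEN_of_ainvs_of_kuriharaNumber_ne_zero_of_card_selmerGroup_of_countPointsFast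
    hK25s hCT hGZK hmod 1 (-1) 0 (-17713175) 28698543082
    (isGloballyMinimal_of_krausCriterion_bounded 1 (-1) 0 (-17713175) 28698543082
      (by decide +kernel) (by decide +kernel) (by decide +kernel))
    (by decide) (n₃ := 4) (by decide +kernel) (by decide) 13 (by norm_num) (by decide) (by decide)
    surj_x7r1_175591d1_3 hr D (k := 3) (by norm_num) (by norm_num)
    11719 (hℓ := ⟨by norm_num⟩) (by norm_num) (by decide) (by decide) (nℓ := 11772)
    (by decide +kernel)
    (by decide) (by decide +kernel) (by decide +kernel) ψ hψ hδ hcard hq hv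

end Summit.BirchSwinnertonDyer.Rank1Residual.Supersingular

end
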